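import Literature.MathematicalPhysics.QuantumFieldTheory.Balaban1983to89.T4ReflectionConeSharp
import Literature.MathematicalPhysics.QuantumFieldTheory.Balaban1983to89.B5Eq118OneStroke
import Literature.MathematicalPhysics.QuantumFieldTheory.Balaban1983to89.B10Eq42TorusConstraint
import Summits.QuantumFields.Balaban3D.Carriers.Regions
import HarnessLib

/-!
# `AlphaInputsT3ACv3AvgIterLocality` — (FL) residual (r4): **THE REGIONAL ∕ STENCIL TWO-BLOCK LOCALITY OF THE `k`-FOLD AVERAGE `avg^k`** — the `k`-fold (0.4) average at a
# level-`k` bond `c` reads the finest field ONLY on the bonds with BOTH endpoints in the two `k`-blocks `B^k(c₋) ∪ B^k(c₊)` — lane `pub-balaban3d` ∕ cell `ym3-torus`, seat alpha-2 (g6)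

WHY (cell `ym3-torus` STATUS: ★★OWNER g25 02:07:30Z «(r4) regional two-block locality of `avg^k` → next free 19936 hand»; ★w4-19936 PROGRESS 5 «what is left for
`hLift`: (2) the regional two-block locality of `avg^k` to run R3 on the stencil-gauged background modified to `1` off the stencil»; ★w1-19936 g2 START v3 (D)).  The exact
non-abelian `k`-fold lift is proved on the WHOLE torus in a flat frame (`NewtonLiftFlat.exists_exact_lift_flat(_allL)`); its regional ∕ stencil execution replaces the background by
a field that agrees with it on a STENCIL `S` (a union of `k`-blocks around the bond under repair) and is `1` (or anything) elsewhere, runs the torus estimates there, and transfers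
the result back — which is legitimate exactly when `avg^k U (c)` depends on `U` only through the bonds with both endpoints in `B^k(c₋) ∪ B^k(c₊) ⊆ S`.  The tree holds the ONE-STEP
statement (`T4ReflectionConeSharp.avgFun_congr₂` ∕ `twoBlockLocal_blockAvg`, [Balaban1987RG1] (0.4): every loop of (0.4) lies in `B(c₋) ∪ B(c₊)`), its `k`-step propagation over an
ABSTRACT exactly dependency-closed family (`LocalSmallLoop.iter_blockAvg_local₂`, instantiated only at the whole region `Ω_k(h)`), and the LINEAR twin with the concrete two-`k`-block
geometry (`LinearLiftSpread.linAvgIter_congr₂`).  THIS FILE supplies the missing GROUP statement with the concrete geometry, stencil-sized, in both block currencies of the lane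
(`B5Eq118OneStroke.iterBlockOf` of the (LL) engine and `Carriers.coarsen` ∕ `B10Eq38TorusDomains.toFine` of the `hLift` binder ∕ `exists_linearLift_region`), with LIGHT imports (no
(LL) ∕ Newton stack) so that every 19936 file can use it.
WHAT (def-free).  §1 ★ `iter_congr₂` — for ANY family of two-block-local averagings (`TwoBlockLocal`), two finest configurations agreeing on the bonds with both ends in
`B^s(c₋) ∪ B^s(c₊)` have the same `s`-fold average at `c` (GROUP twin of `linAvgIter_congr₂`, same induction); ★ `iter_blockAvg_congr₂` (Bałaban's (0.4) `blockAvg ℰ`, any small-loop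
average `ℰ` — in particular `expMeanLogSU`), `iter_axial_congr₂`.  §2 ★★ STENCIL form `iter_congr₂_of_blocks_subset`: agreement on the bonds with both ends in ANY set `S ⊇ B^s(c₋) ∪ B^s(c₊)`
suffices («background modified off the stencil» = the case `U' :=` the `S`-cutoff of `U`); `plaqHol_iter_congr₂` (a level-`s` plaquette of `avg^s U` reads the four `s`-blocks of its
corners).  §3 the REGION currency: bridge `coarsen_eq_iterBlockOf`; ★★ `iter_congr₂_bondsIn` — for a set `S` containing the `s`-block of each of its level-`s` centres
(`toFine s (coarsen s w) ∈ S → w ∈ S`, one direction of the binder `hΩ` of `exists_linearLift_region`), agreement on `bondsIn 0 S` gives agreement of `avg^s` on `bondsIn s S`;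
`plaqHol_iter_congr₂_plaqsIn` (on `plaqsIn s S`); the `blockAvg` specialisations by name.
HONEST FRAMING.  Kernel bookkeeping of [Balaban1987RG1] (0.4)'s dependence set, iterated; no estimate; count-neutral helper toward the (FL)∕KIN row `hLift` of R3 2′∕2′χ
(`stub_laneRecordsV3`, items 19935∕19936 — NOT proved here); registry untouched; nothing about d = 4, the continuum limit, or a mass gap; YM₃ on T³ is rung R3, not the Clay problem.

References: T. Bałaban, Commun. Math. Phys. 109 (1987) 249–301 [Balaban1987RG1] ((0.3) p.252, (0.4)+(0.11) p.253); Commun. Math. Phys. 98 (1985) 17–51 [Balaban1985Averaging]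
(p.24, locality of the averaging operation); Commun. Math. Phys. 102 (1985) 277–309 [Balaban1985Variational] ((3) p.278, the constraint on a region).
-/

set_option autoImplicit false

namespace Summit.QuantumFields.YangMills.Theorems.AvgIterLocality

open Literature.MathematicalPhysics.QuantumFieldTheory.Balaban1983to89
open Literature.MathematicalPhysics.QuantumFieldTheory.Balaban1983to89.T4ReflectionConeSharp (TwoBlockLocal twoBlockLocal_blockAvg twoBlockLocal_axial)
open Literature.MathematicalPhysics.QuantumFieldTheory.Balaban1983to89.B5Eq118OneStroke (iterBlockOf iterBlockOf_succ)
open Literature.MathematicalPhysics.QuantumFieldTheory.Balaban1983to89.BlockAveraging (blockAvg)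
open Literature.MathematicalPhysics.QuantumFieldTheory.Balaban1983to89.AveragingRT (axial)
open Literature.MathematicalPhysics.QuantumFieldTheory.Balaban1983to89.B10Eq38TorusDomains (toFine plaqsIn cornerSet mem_plaqsIn_iff)
open Literature.MathematicalPhysics.QuantumFieldTheory.Balaban1983to89.B10Eq42TorusConstraint (bondsIn mem_bondsIn_iff)
open Summit.QuantumFields.Balaban3D.Carriers (coarsen coarsen_succ)

variable {P : Params} {G : Type*} [GaugeGroup G]

/-! ## §1 The `s`-fold average at `c` reads the finest bonds with both ends in `B^s(c₋) ∪ B^s(c₊)` -/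

/-- **★ TWO-`s`-BLOCK LOCALITY OF THE ITERATED AVERAGE** (any family of two-block-local one-step averagings, standing range `s ≤ m + K`): two finest-lattice configurations that
agree on every bond with BOTH endpoints in the two `s`-blocks `B^s(c₋) ∪ B^s(c₊)` of a level-`s` bond `c` have the same `s`-fold average at `c`.  Induction on `s`: the last step
reads the level-`s` bonds with both ends in `B(c₋) ∪ B(c₊)` (`TwoBlockLocal`), and the `s`-blocks of their ends lie in the `(s+1)`-blocks of `c`'s ends (`iterBlockOf_succ`) — the
GROUP twin of `LinearLiftSpread.linAvgIter_congr₂`. [cite: Balaban1987RG1, (0.4)+(0.11) p.253] -/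
theorem iter_congr₂ (av : ∀ j, Averaging P j G) (hav : ∀ j, TwoBlockLocal (av j)) {U U' : GaugeField P 0 G} :
    ∀ (s : ℕ), s ≤ P.m + P.K → ∀ (c : PBond P s),
      (∀ b : PBond P 0, (iterBlockOf s b.src = c.src ∨ iterBlockOf s b.src = c.tgt) →
        (iterBlockOf s b.tgt = c.src ∨ iterBlockOf s b.tgt = c.tgt) → U b = U' b) →
      Averaging.iter av s U c = Averaging.iter av s U' c
  | 0, _, c, h => h c (Or.inl rfl) (Or.inr rfl)
  | s + 1, hs, c, h => by
    show (av s).avg (Averaging.iter av s U) c = (av s).avg (Averaging.iter av s U') c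
    refine hav s hs _ _ c fun b' h1 h2 => iter_congr₂ av hav s (Nat.le_of_succ_le hs) b' fun b hb1 hb2 => h b ?_ ?_
    · rw [iterBlockOf_succ]
      rcases hb1 with e | e
      · rw [e]; exact h1
      · rw [e]; exact h2
    · rw [iterBlockOf_succ]
      rcases hb2 with e | e
      · rw [e]; exact h1
      · rw [e]; exact h2

/-- **★ BAŁABAN'S `s`-FOLD BLOCK AVERAGE (0.4) IS TWO-`s`-BLOCK LOCAL**, for every small-loop average `ℰ` (in particular the exp-mean-log average `expMeanLogSU` of the lane):
`(blockAvg ℰ)^s U (c)` depends on `U` only through the bonds with both endpoints in `B^s(c₋) ∪ B^s(c₊)`. [cite: Balaban1987RG1, (0.4)+(0.11) p.253] -/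
theorem iter_blockAvg_congr₂ (ℰ : LoopAverage G) {U U' : GaugeField P 0 G} {s : ℕ} (hs : s ≤ P.m + P.K) (c : PBond P s)
    (h : ∀ b : PBond P 0, (iterBlockOf s b.src = c.src ∨ iterBlockOf s b.src = c.tgt) →
      (iterBlockOf s b.tgt = c.src ∨ iterBlockOf s b.tgt = c.tgt) → U b = U' b) :
    Averaging.iter (fun j => (blockAvg ℰ : Averaging P j G)) s U c = Averaging.iter (fun j => (blockAvg ℰ : Averaging P j G)) s U' c :=
  iter_congr₂ (fun j => (blockAvg ℰ : Averaging P j G)) (fun _ => twoBlockLocal_blockAvg ℰ) s hs c h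

/-- The `s`-fold AXIAL average (straight-line transporters, `AveragingRT.axial`) is two-`s`-block local. [cite: Balaban1984PropagatorsI, (1.7) p.18] -/
theorem iter_axial_congr₂ {U U' : GaugeField P 0 G} {s : ℕ} (hs : s ≤ P.m + P.K) (c : PBond P s)
    (h : ∀ b : PBond P 0, (iterBlockOf s b.src = c.src ∨ iterBlockOf s b.src = c.tgt) →
      (iterBlockOf s b.tgt = c.src ∨ iterBlockOf s b.tgt = c.tgt) → U b = U' b) :
    Averaging.iter (fun j => (axial : Averaging P j G)) s U c = Averaging.iter (fun j => (axial : Averaging P j G)) s U' c :=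
  iter_congr₂ (fun j => (axial : Averaging P j G)) (fun _ => twoBlockLocal_axial) s hs c h

/-! ## §2 Stencil form: agreement on any set containing the two blocks; plaquettes of the averaged field -/

/-- **★★ STENCIL LOCALITY** (standing range): if `U` and `U'` agree on every finest bond with both endpoints in a set `S` of fine sites, and `S` contains the two `s`-blocks
`B^s(c₋) ∪ B^s(c₊)` of the level-`s` bond `c`, then `avg^s U (c) = avg^s U' (c)` — `S` is ANY set: a stencil of blocks around `c`, a union of blocks, a region `Ω_k(h)`; the
«background modified to `1` off the stencil» is the case `U' := (U on the bonds inside S, 1 elsewhere)`. [cite: Balaban1987RG1, (0.4)+(0.11) p.253] -/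
theorem iter_congr₂_of_blocks_subset (av : ∀ j, Averaging P j G) (hav : ∀ j, TwoBlockLocal (av j)) {s : ℕ} (hs : s ≤ P.m + P.K)
    (S : Set (Site P 0)) {U U' : GaugeField P 0 G} (hUU' : ∀ b : PBond P 0, b.src ∈ S → b.tgt ∈ S → U b = U' b) (c : PBond P s)
    (hc : ∀ x : Site P 0, (iterBlockOf s x = c.src ∨ iterBlockOf s x = c.tgt) → x ∈ S) :
    Averaging.iter av s U c = Averaging.iter av s U' c :=
  iter_congr₂ av hav s hs c fun b hb1 hb2 => hUU' b (hc _ hb1) (hc _ hb2)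

/-- `blockAvg` form of the stencil locality. [cite: Balaban1987RG1, (0.4)+(0.11) p.253] -/
theorem iter_blockAvg_congr₂_of_blocks_subset (ℰ : LoopAverage G) {s : ℕ} (hs : s ≤ P.m + P.K)
    (S : Set (Site P 0)) {U U' : GaugeField P 0 G} (hUU' : ∀ b : PBond P 0, b.src ∈ S → b.tgt ∈ S → U b = U' b) (c : PBond P s)
    (hc : ∀ x : Site P 0, (iterBlockOf s x = c.src ∨ iterBlockOf s x = c.tgt) → x ∈ S) :
    Averaging.iter (fun j => (blockAvg ℰ : Averaging P j G)) s U c = Averaging.iter (fun j => (blockAvg ℰ : Averaging P j G)) s U' c :=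
  iter_congr₂_of_blocks_subset (fun j => (blockAvg ℰ : Averaging P j G)) (fun _ => twoBlockLocal_blockAvg ℰ) hs S hUU' c hc

/-- **PLAQUETTES OF THE AVERAGED FIELD ARE FOUR-`s`-BLOCK LOCAL**: the holonomy of `avg^s U` around a level-`s` plaquette `Q` depends on `U` only through the finest bonds with both
endpoints in the four `s`-blocks of the corners of `Q` (each of the four bonds of `Q` has its two ends among the corners; `Site.shift_comm` for the far corner).
[cite: Balaban1987RG1, (0.4)+(0.11) p.253] -/
theorem plaqHol_iter_congr₂ (av : ∀ j, Averaging P j G) (hav : ∀ j, TwoBlockLocal (av j)) {s : ℕ} (hs : s ≤ P.m + P.K)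
    {U U' : GaugeField P 0 G} (Q : Plaq P s)
    (h : ∀ b : PBond P 0,
      (iterBlockOf s b.src = Q.src ∨ iterBlockOf s b.src = Q.src.shift Q.μ ∨ iterBlockOf s b.src = Q.src.shift Q.ν ∨
        iterBlockOf s b.src = (Q.src.shift Q.μ).shift Q.ν) →
      (iterBlockOf s b.tgt = Q.src ∨ iterBlockOf s b.tgt = Q.src.shift Q.μ ∨ iterBlockOf s b.tgt = Q.src.shift Q.ν ∨
        iterBlockOf s b.tgt = (Q.src.shift Q.μ).shift Q.ν) → U b = U' b) :
    GaugeField.plaqHol (Averaging.iter av s U) Q = GaugeField.plaqHol (Averaging.iter av s U') Q := by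
  have e1 : Averaging.iter av s U ⟨Q.src, Q.μ⟩ = Averaging.iter av s U' ⟨Q.src, Q.μ⟩ :=
    iter_congr₂ av hav s hs _ fun b hb1 hb2 =>
      h b (by rcases hb1 with e | e; exacts [Or.inl e, Or.inr (Or.inl e)]) (by rcases hb2 with e | e; exacts [Or.inl e, Or.inr (Or.inl e)])
  have e2 : Averaging.iter av s U ⟨Q.src.shift Q.μ, Q.ν⟩ = Averaging.iter av s U' ⟨Q.src.shift Q.μ, Q.ν⟩ :=
    iter_congr₂ av hav s hs _ fun b hb1 hb2 =>
      h b (by rcases hb1 with e | e; exacts [Or.inr (Or.inl e), Or.inr (Or.inr (Or.inr e))])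
        (by rcases hb2 with e | e; exacts [Or.inr (Or.inl e), Or.inr (Or.inr (Or.inr e))])
  have e3 : Averaging.iter av s U ⟨Q.src.shift Q.ν, Q.μ⟩ = Averaging.iter av s U' ⟨Q.src.shift Q.ν, Q.μ⟩ := by
    refine iter_congr₂ av hav s hs _ fun b hb1 hb2 => h b ?_ ?_
    · rcases hb1 with e | e
      · exact Or.inr (Or.inr (Or.inl e))
      · refine Or.inr (Or.inr (Or.inr ?_)); rw [e]; exact (Site.shift_comm Q.src Q.ν Q.μ)
    · rcases hb2 with e | e
      · exact Or.inr (Or.inr (Or.inl e))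
      · refine Or.inr (Or.inr (Or.inr ?_)); rw [e]; exact (Site.shift_comm Q.src Q.ν Q.μ)
  have e4 : Averaging.iter av s U ⟨Q.src, Q.ν⟩ = Averaging.iter av s U' ⟨Q.src, Q.ν⟩ :=
    iter_congr₂ av hav s hs _ fun b hb1 hb2 =>
      h b (by rcases hb1 with e | e; exacts [Or.inl e, Or.inr (Or.inr (Or.inl e))]) (by rcases hb2 with e | e; exacts [Or.inl e, Or.inr (Or.inr (Or.inl e))])
  simp only [GaugeField.plaqHol, e1, e2, e3, e4]

/-- Stencil form for plaquettes: agreement on the bonds inside any set `S` containing the four corner `s`-blocks of `Q`. [cite: Balaban1987RG1, (0.4)+(0.11) p.253] -/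
theorem plaqHol_iter_congr₂_of_blocks_subset (av : ∀ j, Averaging P j G) (hav : ∀ j, TwoBlockLocal (av j)) {s : ℕ} (hs : s ≤ P.m + P.K)
    (S : Set (Site P 0)) {U U' : GaugeField P 0 G} (hUU' : ∀ b : PBond P 0, b.src ∈ S → b.tgt ∈ S → U b = U' b) (Q : Plaq P s)
    (hQ : ∀ x : Site P 0, (iterBlockOf s x = Q.src ∨ iterBlockOf s x = Q.src.shift Q.μ ∨ iterBlockOf s x = Q.src.shift Q.ν ∨
      iterBlockOf s x = (Q.src.shift Q.μ).shift Q.ν) → x ∈ S) :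
    GaugeField.plaqHol (Averaging.iter av s U) Q = GaugeField.plaqHol (Averaging.iter av s U') Q :=
  plaqHol_iter_congr₂ av hav hs Q fun b hb1 hb2 => hUU' b (hQ _ hb1) (hQ _ hb2)

/-! ## §3 The region currency: `coarsen` ∕ `toFine`, `bondsIn`, `plaqsIn` -/

/-- BRIDGE OF THE TWO BLOCK CURRENCIES: the lane's `Carriers.coarsen s` (`blockOf ∘ … ∘ blockOf`) is the (LL) engine's `B5Eq118OneStroke.iterBlockOf s`. [folklore] -/
theorem coarsen_eq_iterBlockOf : ∀ (s : ℕ) (x : Site P 0), coarsen s x = iterBlockOf s x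
  | 0, _ => rfl
  | s + 1, x => by rw [coarsen_succ, iterBlockOf_succ, coarsen_eq_iterBlockOf s x]

/-- If `S` contains the `s`-block of each of its level-`s` centres (one direction of the saturation binder `w ∈ S ↔ toFine s (coarsen s w) ∈ S` of `exists_linearLift_region`), then
the two `s`-blocks of a bond of `bondsIn s S` lie in `S`. [cite: Balaban1985Variational, (3) p.278] -/
theorem blocks_subset_of_mem_bondsIn {s : ℕ} {S : Set (Site P 0)} (hS : ∀ w : Site P 0, toFine s (coarsen s w) ∈ S → w ∈ S)
    {c : PBond P s} (hc : c ∈ bondsIn s S) (x : Site P 0) (hx : iterBlockOf s x = c.src ∨ iterBlockOf s x = c.tgt) : x ∈ S := by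
  refine hS x ?_
  rw [coarsen_eq_iterBlockOf]
  rcases hx with e | e
  · rw [e]; exact hc.1
  · rw [e]; exact hc.2

/-- If `S` contains the `s`-block of each of its level-`s` centres, the four corner `s`-blocks of a plaquette of `plaqsIn s S` lie in `S`. [cite: Balaban1985UV3, (38) p.266] -/
theorem blocks_subset_of_mem_plaqsIn {s : ℕ} {S : Set (Site P 0)} (hS : ∀ w : Site P 0, toFine s (coarsen s w) ∈ S → w ∈ S)
    {Q : Plaq P s} (hQ : Q ∈ plaqsIn s S) (x : Site P 0)
    (hx : iterBlockOf s x = Q.src ∨ iterBlockOf s x = Q.src.shift Q.μ ∨ iterBlockOf s x = Q.src.shift Q.ν ∨ iterBlockOf s x = (Q.src.shift Q.μ).shift Q.ν) :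
    x ∈ S := by
  rw [mem_plaqsIn_iff] at hQ
  refine hS x ?_
  rw [coarsen_eq_iterBlockOf]
  have mem : ∀ y : Site P s, y = Q.src ∨ y = Q.src.shift Q.μ ∨ y = Q.src.shift Q.ν ∨ y = (Q.src.shift Q.μ).shift Q.ν → toFine s y ∈ S := by
    intro y hy
    apply hQ
    simp only [cornerSet, Set.mem_insert_iff, Set.mem_singleton_iff]
    rcases hy with e | e | e | e <;> simp [e]
  exact mem _ hx

/-- **★★ REGIONAL LOCALITY ON `bondsIn`** (standing range): if `S` contains the `s`-block of each of its level-`s` centres and `U`, `U'` agree on the finest bonds with both endpoints in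
`S` (`bondsIn 0 S`), then `avg^s U = avg^s U'` on every level-`s` bond with both endpoints in `S` (`bondsIn s S`) — for ANY two-block-local family; the seam is free: nothing is asked
of `U`, `U'` on bonds with an endpoint outside `S`. [cite: Balaban1985Variational, (3) p.278; Balaban1987RG1, (0.4) p.253] -/
theorem iter_congr₂_bondsIn (av : ∀ j, Averaging P j G) (hav : ∀ j, TwoBlockLocal (av j)) {s : ℕ} (hs : s ≤ P.m + P.K)
    {S : Set (Site P 0)} (hS : ∀ w : Site P 0, toFine s (coarsen s w) ∈ S → w ∈ S)
    {U U' : GaugeField P 0 G} (hUU' : ∀ b : PBond P 0, b ∈ bondsIn 0 S → U b = U' b)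
    (c : PBond P s) (hc : c ∈ bondsIn s S) :
    Averaging.iter av s U c = Averaging.iter av s U' c :=
  iter_congr₂_of_blocks_subset av hav hs S (fun b h1 h2 => hUU' b ⟨h1, h2⟩) c (blocks_subset_of_mem_bondsIn hS hc)

/-- **★★ `blockAvg` form** — the letter for the `hLift` binder (`Averaging.iter (fun i => blockAvg ℰp) k U b = V b` on `bondsIn k Ω`): the `k`-fold (0.4) averages on `bondsIn k S` are
determined by the finest field on `bondsIn 0 S`. [cite: Balaban1985Variational, (3) p.278; Balaban1987RG1, (0.4) p.253] -/
theorem iter_blockAvg_congr₂_bondsIn (ℰ : LoopAverage G) {s : ℕ} (hs : s ≤ P.m + P.K)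
    {S : Set (Site P 0)} (hS : ∀ w : Site P 0, toFine s (coarsen s w) ∈ S → w ∈ S)
    {U U' : GaugeField P 0 G} (hUU' : ∀ b : PBond P 0, b ∈ bondsIn 0 S → U b = U' b)
    (c : PBond P s) (hc : c ∈ bondsIn s S) :
    Averaging.iter (fun j => (blockAvg ℰ : Averaging P j G)) s U c = Averaging.iter (fun j => (blockAvg ℰ : Averaging P j G)) s U' c :=
  iter_congr₂_bondsIn (fun j => (blockAvg ℰ : Averaging P j G)) (fun _ => twoBlockLocal_blockAvg ℰ) hs hS hUU' c hc

/-- **REGIONAL LOCALITY OF THE AVERAGED PLAQUETTES ON `plaqsIn`**: under the same saturation, agreement on `bondsIn 0 S` gives equal holonomies of `avg^s U` and `avg^s U'` around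
every plaquette of `plaqsIn s S`. [cite: Balaban1985UV3, (38) p.266; Balaban1987RG1, (0.4) p.253] -/
theorem plaqHol_iter_congr₂_plaqsIn (av : ∀ j, Averaging P j G) (hav : ∀ j, TwoBlockLocal (av j)) {s : ℕ} (hs : s ≤ P.m + P.K)
    {S : Set (Site P 0)} (hS : ∀ w : Site P 0, toFine s (coarsen s w) ∈ S → w ∈ S)
    {U U' : GaugeField P 0 G} (hUU' : ∀ b : PBond P 0, b ∈ bondsIn 0 S → U b = U' b)
    (Q : Plaq P s) (hQ : Q ∈ plaqsIn s S) :
    GaugeField.plaqHol (Averaging.iter av s U) Q = GaugeField.plaqHol (Averaging.iter av s U') Q :=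
  plaqHol_iter_congr₂_of_blocks_subset av hav hs S (fun b h1 h2 => hUU' b ⟨h1, h2⟩) Q (blocks_subset_of_mem_plaqsIn hS hQ)

/-- `blockAvg` form of the regional plaquette locality. [cite: Balaban1985UV3, (38) p.266; Balaban1987RG1, (0.4) p.253] -/
theorem plaqHol_iter_blockAvg_congr₂_plaqsIn (ℰ : LoopAverage G) {s : ℕ} (hs : s ≤ P.m + P.K)
    {S : Set (Site P 0)} (hS : ∀ w : Site P 0, toFine s (coarsen s w) ∈ S → w ∈ S)
    {U U' : GaugeField P 0 G} (hUU' : ∀ b : PBond P 0, b ∈ bondsIn 0 S → U b = U' b)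
    (Q : Plaq P s) (hQ : Q ∈ plaqsIn s S) :
    GaugeField.plaqHol (Averaging.iter (fun j => (blockAvg ℰ : Averaging P j G)) s U) Q =
      GaugeField.plaqHol (Averaging.iter (fun j => (blockAvg ℰ : Averaging P j G)) s U') Q :=
  plaqHol_iter_congr₂_plaqsIn (fun j => (blockAvg ℰ : Averaging P j G)) (fun _ => twoBlockLocal_blockAvg ℰ) hs hS hUU' Q hQ

end Summit.QuantumFields.YangMills.Theorems.AvgIterLocality
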